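import Literature.Topology.FourManifolds.FishtailParamsFacts
import Literature.Topology.FourManifolds.FishtailTubeD
import HarnessLib

/-!
# Facts about the concrete fishtail parameters, II: plateau structures and the cap section

Infrastructure for the explicit fishtail neighbourhood (R. Gompf, *More Cappell–Shaneson spheres
are standard*, Algebr. Geom. Topol. 10 (2010), proof of Thm 2.1 and Lemma 2.2; the named fact
`Literature.Topology.FourManifolds.gompf2010_framedTwist`). For the concrete tube data
`fishT ε hε hε2`:

* a positivity criterion for the Jacobian of the switch zones (`jac_switch_pos`);
* smoothness of the section on the cap disc off the puncture, for the concrete step width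
  `δ = 1/200` and blend radii `(1/5, 1/4, 3/10)` (`eventually_contMDiffAt_sigmaCapC`): on the arc
  through the puncture, `1/5` away from it, the step is saturated;
* the plateau structures `D0NPlateau`, `D0APlateau` of the concrete data.

Everything is proved; no named facts.

## References

* R. E. Gompf, *More Cappell–Shaneson spheres are standard*, Algebr. Geom. Topol. 10 (2010)
  1665–1681, proof of Thm 2.1 and Lemma 2.2. [GompfAGT2010]
-/

noncomputable section

open scoped Real Topology ContDiff Manifold
open Set Filter Complex

namespace Literature.Topology.FourManifolds

/-! ### The Jacobian of the switch zones -/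

/-- `n - √(n² - s) ≤ s / n` for `0 ≤ s < n²`, `0 < n`. [folklore] -/
theorem sub_sqrt_le {n s : ℝ} (hn : 0 < n) (hs0 : 0 ≤ s) (hs : s < n ^ 2) : n - Real.sqrt (n ^ 2 - s) ≤ s / n := by
  have h1 : n - s / n ≤ Real.sqrt (n ^ 2 - s) := by
    rcases le_or_gt (n - s / n) 0 with h | h
    · exact h.trans (Real.sqrt_nonneg _)
    · rw [Real.le_sqrt h.le (by linarith)]
      have : (n - s / n) ^ 2 = n ^ 2 - 2 * s + (s / n) ^ 2 := by
        rw [sub_sq, div_pow, show 2 * n * (s / n) = 2 * s by field_simp]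
      rw [this]
      have h2 : (s / n) ^ 2 ≤ s := by
        rw [div_pow, div_le_iff₀ (by positivity)]
        nlinarith
      linarith
  linarith

/-- **Positivity of the switch Jacobian.** With `μ ≤ 1`, `|μ'| ≤ M`, `0 < n`,
`A² + B² < n²`, `X = sphX n A B`, and `M (|B| + (A² + B²)/n) < 1`:
`-μ' X + (1 - μ) (n / X) + (μ' (n + B) + μ) > 0`. [folklore] -/
theorem jac_switch_pos {μ μ' M n A B : ℝ} (hμ1 : μ ≤ 1) (hM : |μ'| ≤ M) (hn : 0 < n)
    (hAB : A ^ 2 + B ^ 2 < n ^ 2) (hsmall : M * (|B| + (A ^ 2 + B ^ 2) / n) < 1) :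
    0 < -μ' * sphX n A B + (1 - μ) * (n / Real.sqrt (n ^ 2 - A ^ 2 - B ^ 2)) + (μ' * (n + B) + μ * 1) := by
  set X := Real.sqrt (n ^ 2 - A ^ 2 - B ^ 2) with hX
  have hXeq : sphX n A B = X := rfl
  have hpos : 0 < n ^ 2 - A ^ 2 - B ^ 2 := by linarith
  have hX0 : 0 < X := Real.sqrt_pos.2 hpos
  have hXle : X ≤ n := by
    rw [hX, Real.sqrt_le_left hn.le]; nlinarith
  have hnX : 1 ≤ n / X := by rw [le_div_iff₀ hX0]; linarith
  have hsub : n - X ≤ (A ^ 2 + B ^ 2) / n := by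
    have := sub_sqrt_le hn (by positivity : 0 ≤ A ^ 2 + B ^ 2) (by linarith)
    rwa [show n ^ 2 - (A ^ 2 + B ^ 2) = n ^ 2 - A ^ 2 - B ^ 2 by ring] at this
  rw [hXeq]
  -- `J = (1-μ) n/X + μ + μ' (n + B - X)`
  have hJ : -μ' * X + (1 - μ) * (n / X) + (μ' * (n + B) + μ * 1) = (1 - μ) * (n / X) + μ + μ' * (n + B - X) := by ring
  rw [hJ]
  have h1 : 1 ≤ (1 - μ) * (n / X) + μ := by nlinarith
  have h2 : |μ' * (n + B - X)| ≤ M * (|B| + (A ^ 2 + B ^ 2) / n) := by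
    rw [abs_mul]
    refine mul_le_mul hM ?_ (abs_nonneg _) (le_trans (abs_nonneg _) hM)
    calc |n + B - X| = |B + (n - X)| := by rw [show n + B - X = B + (n - X) by ring]
      _ ≤ |B| + |n - X| := abs_add_le _ _
      _ = |B| + (n - X) := by rw [abs_of_nonneg (show (0:ℝ) ≤ n - X by linarith)]
      _ ≤ |B| + (A ^ 2 + B ^ 2) / n := by linarith
  have h3 := neg_abs_le (μ' * (n + B - X))
  linarith

/-! ### The section on the cap disc for the concrete radii -/

section Sigma

variable {tj : ℝ}

/-- `capS d - 3/4 = (arg d + π/2) / (2π)`. [folklore] -/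
theorem capS_sub (d : ℂ) : capS d - 3 / 4 = (arg d + π / 2) / (2 * π) := by
  rw [capS]; field_simp; ring

/-- `‖e^{ia} - e^{ib}‖ ≤ |a - b|`. [folklore] -/
theorem norm_exp_mul_I_sub_le (a b : ℝ) : ‖exp (a * I) - exp (b * I)‖ ≤ |a - b| := by
  have h1 : exp (a * I) - exp (b * I) = exp (b * I) * (exp (I * ↑(a - b)) - 1) := by
    rw [mul_sub, mul_one, ← Complex.exp_add]
    congr 1; push_cast; ring
  rw [h1, norm_mul, Complex.norm_exp_ofReal_mul_I, one_mul]
  have := Real.norm_exp_I_mul_ofReal_sub_one_le (x := a - b)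
  rwa [Real.norm_eq_abs] at this

/-- `d_c = t_j e^{-iπ/2}`. [folklore] -/
theorem dCenter_eq_exp (tj : ℝ) : dCenter tj = (tj : ℂ) * exp ((-(π / 2) : ℝ) * I) := by
  rw [dCenter, Complex.exp_mul_I, ← Complex.ofReal_cos, ← Complex.ofReal_sin, Real.cos_neg, Real.sin_neg,
    Real.cos_pi_div_two, Real.sin_pi_div_two]
  push_cast; ring

/-- **On the arc through the puncture, `1/5` away from it, the step is saturated**
(`t_j < 21/10`): `|arg d + π/2| ≥ (1/5)/t_j > 2π/200`. [folklore] -/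
theorem capS_far (htj : 0 < tj) (htj' : tj < 21 / 10) {d : ℂ} (hn : ‖d‖ = tj) (hdist : 1 / 5 ≤ ‖d - dCenter tj‖) :
    3 / 4 + 1 / 200 < capS d ∨ capS d < 3 / 4 - 1 / 200 := by
  have hπ := Real.pi_pos
  set φ := arg d with hφ
  have hd : d = (tj : ℂ) * exp (φ * I) := by
    rw [hφ, ← hn]; exact (norm_mul_exp_arg_mul_I d).symm
  have hchord : ‖d - dCenter tj‖ ≤ tj * |φ + π / 2| := by
    rw [hd, dCenter_eq_exp, ← mul_sub, norm_mul, Complex.norm_real, Real.norm_eq_abs, abs_of_pos htj]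
    refine mul_le_mul_of_nonneg_left ?_ htj.le
    have := norm_exp_mul_I_sub_le φ (-(π / 2))
    rwa [sub_neg_eq_add] at this
  have habs : 2 * π * (1 / 200) < |φ + π / 2| := by
    by_contra hle
    rw [not_lt] at hle
    have : tj * |φ + π / 2| < 1 / 5 := by
      calc tj * |φ + π / 2| ≤ tj * (2 * π * (1 / 200)) := mul_le_mul_of_nonneg_left hle htj.le
        _ < 1 / 5 := by nlinarith [Real.pi_lt_d2]
    linarith
  have h := capS_sub d
  rw [← hφ] at h
  rcases lt_or_ge (φ + π / 2) 0 with hneg | hnn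
  · right
    rw [abs_of_neg hneg] at habs
    have : (φ + π / 2) / (2 * π) < -(1 / 200) := by
      rw [div_lt_iff₀ (by positivity)]; linarith
    linarith
  · left
    rw [abs_of_nonneg hnn] at habs
    have : 1 / 200 < (φ + π / 2) / (2 * π) := by
      rw [lt_div_iff₀ (by positivity)]; linarith
    linarith

/-- **In the lower half-plane, where the step is saturated it equals the upper indicator nearby.** [folklore] -/
theorem sStepD_eventuallyEq_gUp {δ : ℝ} (hδ : 0 < δ) {d : ℂ} (him : d.im < 0)
    (h : 3 / 4 + δ < capS d ∨ capS d < 3 / 4 - δ) : (fun d' ↦ sStepD δ d') =ᶠ[𝓝 d] gUp := by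
  have hπ := Real.pi_pos
  have hslit : d ∈ slitPlane := Or.inr him.ne
  have hca : ContinuousAt (fun d' : ℂ ↦ capS d') d := ((continuousAt_arg hslit).div_const _).add continuousAt_const
  have him' : ∀ᶠ d' in 𝓝 d, d'.im < 0 := (isOpen_lt Complex.continuous_im continuous_const).mem_nhds him
  rcases h with h | h
  · filter_upwards [hca.eventually ((isOpen_lt continuous_const continuous_id).mem_nhds h), him'] with d' hd' hi'
    have h1 : sStepD δ d' = 1 := sStep_of_ge hδ (le_of_lt hd')
    -- `arg d' > -π/2 + 2πδ > -π/2` and `im d' < 0` give `re d' > 0`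
    have ha : -(π / 2) < arg d' := by
      have hid : arg d' / (2 * π) + 1 / 4 = (arg d' + π / 2) / (2 * π) := by field_simp; ring
      have h2 : δ < (arg d' + π / 2) / (2 * π) := by simp only [capS, id] at hd'; linarith
      rw [lt_div_iff₀ (by positivity)] at h2
      nlinarith
    have ha' : arg d' < 0 := arg_neg_iff.2 hi'
    have hre : 0 < d'.re := by
      have hc : 0 < Real.cos (arg d') := Real.cos_pos_of_mem_Ioo ⟨ha, by linarith⟩
      have hd0 : d' ≠ 0 := fun h0 ↦ by rw [h0] at hi'; simp at hi'
      have := Complex.cos_arg hd0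
      rw [this] at hc
      exact (div_pos_iff_of_pos_right (norm_pos_iff.2 hd0)).1 hc
    rw [h1, gUp, if_pos hre]
  · filter_upwards [hca.eventually ((isOpen_lt continuous_id continuous_const).mem_nhds h), him'] with d' hd' hi'
    have h1 : sStepD δ d' = 0 := sStep_of_le hδ (le_of_lt hd')
    have ha : arg d' < -(π / 2) := by
      have hid : arg d' / (2 * π) + 1 / 4 = (arg d' + π / 2) / (2 * π) := by field_simp; ring
      have h2 : (arg d' + π / 2) / (2 * π) < -δ := by simp only [capS, id] at hd'; linarith
      rw [div_lt_iff₀ (by positivity)] at h2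
      nlinarith
    have hre : ¬ 0 < d'.re := by
      intro hre
      have hd0 : d' ≠ 0 := fun h0 ↦ by rw [h0] at hi'; simp at hi'
      have hc : Real.cos (arg d') < 0 := by
        rw [← Real.cos_neg]
        exact Real.cos_neg_of_pi_div_two_lt_of_lt (by linarith) (by linarith [neg_pi_lt_arg d'])
      rw [Complex.cos_arg hd0] at hc
      have := div_pos hre (norm_pos_iff.2 hd0)
      linarith
    rw [h1, gUp, if_neg hre]

/-- **The cap section is smooth off the puncture, locally uniformly**, for the concrete step width
`1/200` and blend radii `1/5 < 1/4 < 3/10`, `2 < t_j < 21/10`. [folklore] -/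
theorem eventually_contMDiffAt_sigmaCapC (htj : 2 < tj) (htj' : tj < 21 / 10) {d : ℂ} (hd : d ≠ dCenter tj) :
    ∀ᶠ d' in 𝓝 d, ContMDiffAt 𝓘(ℝ, ℂ) (𝓡 1) ∞ (sigmaCapC tj (1 / 200) (1 / 5) (1 / 4) (3 / 10)) d' := by
  have htj0 : 0 < tj := by linarith
  have hF : ∀ d', 1 / 5 ≤ ‖d' - dCenter tj‖ → ‖d' - dCenter tj‖ ≤ 3 / 10 →
      ContDiffAt ℝ ∞ (seamCorr tj (1 / 200)) d' := fun d' h1 h2 ↦ by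
    have him : d'.im < 0 := by
      have := Complex.abs_im_le_norm (d' - dCenter tj)
      rw [abs_le] at this
      have h3 : (d' - dCenter tj).im = d'.im + tj := by simp [dCenter]
      linarith [this.2]
    have hne : d' ≠ dCenter tj := by
      intro h; rw [h, sub_self, norm_zero] at h1; linarith
    exact contDiffAt_seamCorr htj0 him hne fun hn ↦
      sStepD_eventuallyEq_gUp (by norm_num) him (capS_far htj0 htj' hn h1)
  have hE : ∀ d', 1 / 4 ≤ ‖d' - dCenter tj‖ → ContMDiffAt 𝓘(ℝ, ℂ) (𝓡 1) ∞ (sigmaOutC tj (1 / 200)) d' :=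
    fun d' h1 ↦ contMDiffAt_sigmaOutC htj0 (by norm_num) (by norm_num) fun hn _ ↦
      capS_far htj0 htj' hn (by linarith)
  have ho : IsOpen {d' : ℂ | d' ≠ dCenter tj} := isOpen_ne
  filter_upwards [ho.mem_nhds hd] with d' hd'
  exact contMDiffAt_sigmaCapC (by norm_num) (by norm_num) (by norm_num) hd' hF hE

end Sigma

/-! ### `capLat` is strictly decreasing -/

/-- `t / √(1 + t²) = capLat (-1) t` is strictly increasing (its derivative is `(1+t²)^{-3/2} > 0`). [folklore] -/
theorem strictMono_capLat_neg_one : StrictMono (capLat (-1)) := by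
  refine strictMono_of_deriv_pos fun t ↦ ?_
  rw [(hasDerivAt_capLat (-1) t).deriv]
  have : 0 < (1 + t ^ 2) * Real.sqrt (1 + t ^ 2) := by positivity
  rw [neg_neg]; positivity

/-- `capLat ε t = -ε · capLat (-1) t`. [folklore] -/
theorem capLat_eq_neg_mul (ε t : ℝ) : capLat ε t = -ε * capLat (-1) t := by
  rw [capLat, capLat]; ring

/-- **`capLat ε` is strictly decreasing** (`ε > 0`). [folklore] -/
theorem strictAnti_capLat {ε : ℝ} (hε : 0 < ε) : StrictAnti (capLat ε) := by
  intro a b hab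
  have h := strictMono_capLat_neg_one hab
  have e1 : capLat ε a = -ε * capLat (-1) a := capLat_eq_neg_mul ε a
  have e2 : capLat ε b = -ε * capLat (-1) b := capLat_eq_neg_mul ε b
  rw [e1, e2]
  nlinarith

/-! ### The plateau structures of the concrete data -/

namespace FP

variable {ε : ℝ} (hε : 0 < ε) (hε2 : ε ≤ 1 / 2)

/-- `‖d_c‖ = t_j` (`t_j ≥ 0`). [folklore] -/
theorem norm_dCenter {tj : ℝ} (htj : 0 ≤ tj) : ‖dCenter tj‖ = tj := by
  rw [dCenter, norm_neg, norm_mul, Complex.norm_real, Complex.norm_I, mul_one, Real.norm_eq_abs, abs_of_nonneg htj]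

include hε in
/-- `capN ε d < n_j` for `‖d‖ > t_j` (`capLat` is strictly decreasing and `capLat t_j = n_j`). [folklore] -/
theorem capN_lt_nj {d : ℂ} (hd : capTj ε (nj ε) < ‖d‖) : capN ε d < nj ε := by
  have h := strictAnti_capLat hε hd
  rwa [capTj, capLat_capRad hε (nj_sq_lt ε hε)] at h

include hε hε2 in
/-- **The north plateau structure of the concrete data.** [folklore] -/
theorem d0NPlateau : D0NPlateau ε (capTj ε (nj ε)) (1 / 200) (1 / 5) (1 / 4) (3 / 10) (lam ε) 1 (kap ε) (muN ε) (nj ε)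
    (capTj ε (nj ε) + 3 / 10) where
  hkap := contDiff_kap
  hμ := contDiff_stdBlend _ _
  hμ01 n := stdBlend_mem _ _ n
  hcN := one_ne_zero
  hlam := (lam_pos ε hε).ne'
  cone d hd := by rw [one_mul]; exact kap_of_le hε (neg_capN_lt_of_norm_lt hε hd).le
  klam d hd := kap_of_ge hε (lt_neg_capN_of_lt_norm hε hd).le
  mu0 d hd := muN_of_le hε (neg_capN_lt_of_norm_lt' hε hd).le
  mu1 d hd := muN_of_ge hε (lt_neg_capN_of_lt_norm' hε hd).le
  sig1 d hd := by
    obtain ⟨ht1, ht2⟩ := capTj_bounds ε hε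
    have hdist : 1 / 4 ≤ ‖d - dCenter (capTj ε (nj ε))‖ := by
      have h1 := norm_sub_norm_le (dCenter (capTj ε (nj ε))) d
      rw [norm_dCenter (by linarith), norm_sub_rev] at h1
      linarith
    rw [sigmaCapC_of_le_norm (by norm_num) (by norm_num) hdist]
    exact sigmaOutC_eq_one_of_norm_le (by linarith)
  hr1 := by norm_num
  hr12 := by norm_num
  hδ := by norm_num
  hδ' := by norm_num
  hc1 := by unfold nj; linarith [Real.pi_gt_three]
  hc2 := by unfold nj; linarith
  hRM := by linarith [(capTj_bounds ε hε).1]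
  far d hd := by
    obtain ⟨ht1, ht2⟩ := capTj_bounds ε hε
    have hdt : capTj ε (nj ε) < ‖d‖ := by linarith
    have hcap : capN ε d < nj ε := capN_lt_nj hε hdt
    have hcap2 : -capN ε d < ε := neg_capN_lt_eps hε d
    have hnj : nj ε = -(9 * ε / 10) := rfl
    refine ⟨hdt, ?_, hcap.le, by linarith [Real.pi_gt_three], by linarith [Real.pi_gt_three], ?_⟩
    · have h1 := norm_sub_norm_le d (dCenter (capTj ε (nj ε)))
      rw [norm_dCenter (by linarith)] at h1
      linarith
    · have h := mul_exp_mem_slitPlane_of_mem_Ioo (c := nj ε) (θ := capN ε d + 2 * π) (by linarith [Real.pi_gt_three])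
        (by linarith)
      rwa [Circle.exp_add, Circle.exp_two_pi, mul_one] at h

include hε hε2 in
/-- **The south (angular) plateau structure of the concrete data.** [folklore] -/
theorem d0APlateau : D0APlateau (1 / 200) (lam ε) (nj ε) (kap ε) (muS ε) (nA ε) (nB ε) (etaA ε) where
  hkap := contDiff_kap
  hμ := contDiff_stdBlend _ _
  hμ01 n := stdBlend_mem _ _ n
  hlam := (lam_pos ε hε).ne'
  hη := by unfold etaA; positivity
  hc1 := by unfold nj; linarith [Real.pi_gt_three]
  hc2 := by unfold nj; linarith
  hδ := by norm_num
  hδ' := by norm_num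
  hA0 := by unfold etaA nA; linarith
  hAB := by unfold etaA nA nB; linarith
  hB := by unfold etaA nB; linarith
  klam n hn := by unfold etaA nA at hn; exact kap_of_ge hε (by linarith)
  mu0 n hn := by unfold etaA nA at hn; exact muS_of_le hε (by linarith)
  mu1 n hn := by unfold etaA nB at hn; exact muS_of_ge hε (by linarith)
  sig0 n hn s := by
    unfold etaA nB at hn
    obtain ⟨h1, h2⟩ := abs_lt.1 hn
    have hnj : nj ε = -(9 * ε / 10) := rfl
    rw [sigmaFar, seamLift_exp (by linarith) (by linarith [Real.pi_gt_three]),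
      Real.smoothTransition.zero_of_nonpos (by linarith), mul_zero, mul_zero]

end FP

end Literature.Topology.FourManifolds
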